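import Mathlib
import Literature.Probability.LatticeModels.LatticeGraph
import HarnessLib

/-!
# Aggregation of the block pair Gram bounds: shell split, power mean, and Cauchy–Schwarz over the translates

Support for the cruxes `NoInfraredPileUp` (stmt-HubbardSuperconductivity-18534) and
`NoNormalLimitState` (stmt-HubbardSuperconductivity-18533) of route `InfiniteVolumeFirst`: the
purely real-analytic core of steps S6+S9 of the coarse-tightness / atom-ceiling programme
(`PLAN-coarse-tightness.md` attached to the item). It turns

* the block pair Gram bounds (`blockPairGram_bound`, file
  `InfiniteVolumeFirstCoarseTightnessBlockPairGramBound.lean`): per translate `a`,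
  `m_a ≤ P + Q (Σ_j x_{aj} + (Σ_j t_{aj})²)`, `t = (x(1-x))^{1/4}`, `x_{aj} ∈ [0,1]` the occupations
  of the block modes,
* a shell count `#{j : w_j ≤ τ} ≤ N` for the level distances `w_j = |ε_j - μ| ≥ 0`, and
* a budget for the level-weighted smearing summed over the translates,
  `Σ_a Σ_j w_j x_{aj}(1 - x_{aj}) ≤ Bud`,

into ONE bound on the sum over the translates (`sum_le_of_gram_shell_budget`):

  `Σ_a m_a ≤ |A| (P + Q M + 2 Q N²) + 2 Q √(M³ |A| Bud / τ)`,  `M = |J|`.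

Per block the smeared modes split into the shell (each `t ≤ 1`, at most `N` of them) and the rest,
where `t⁴ = x(1-x) ≤ w x(1-x)/τ` and the power-mean inequality (Cauchy–Schwarz twice,
`(Σ t)⁴ ≤ M³ Σ t⁴`) gives `(Σ_off t)² ≤ √(M³ D_a/τ)`, `D_a = Σ_j w_j x_{aj}(1-x_{aj})`; summing over
`a` and Cauchy–Schwarz once more, `Σ_a √D_a ≤ √(|A| Σ_a D_a)`. Divided by `|A| R⁴` (`|A| = L²`,
`M = R²`, `N ≲ √τ R² + R`, `Bud ≲ L² R² (U + C/R)`) this is the mesoscopic pair-order ceiling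
`𝓜 ≤ c₁/R + c₂ √τ + c₃ τ^{-1/2} √(U + c₄/R)` of the programme. Registered stub:
`stub_coarseAggregate` (the same statement with `A = (ℤ/L)²`, `J = [0,R)²`).

Sources: J. Bardeen, L. N. Cooper, J. R. Schrieffer, Phys. Rev. 108 (1957) 1175, §II (smearing
`u_k v_k` costs kinetic energy off the Fermi level); G. H. Hardy, J. E. Littlewood, G. Pólya,
*Inequalities* (1934) §2.9 (power means). Elementary real inequalities; no definition and no
named fact is introduced.
-/

noncomputable section

-- the mandated namespace `Summit.<Summit>.<Problem>.Theorems` repeats `HubbardSuperconductivity`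
-- (single-problem summit, D-0017), which the `dupNamespace` linter flags on every declaration
set_option linter.dupNamespace false

namespace Summit.HubbardSuperconductivity.HubbardSuperconductivity.Theorems.CoarseTightness

open Finset
open Literature.Probability.LatticeModels

/-! ### Elementary inequalities -/

/-- `(x(1-x))^{1/4} ≤ 1` for `0 ≤ x ≤ 1`. [folklore] -/
theorem sqrt_sqrt_mul_one_sub_le_one {x : ℝ} (h0 : 0 ≤ x) (h1 : x ≤ 1) :
    Real.sqrt (Real.sqrt (x * (1 - x))) ≤ 1 := by
  have h : x * (1 - x) ≤ 1 := by nlinarith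
  calc Real.sqrt (Real.sqrt (x * (1 - x))) ≤ Real.sqrt (Real.sqrt 1) :=
        Real.sqrt_le_sqrt (Real.sqrt_le_sqrt h)
    _ = 1 := by rw [Real.sqrt_one, Real.sqrt_one]

/-- **Power mean (Cauchy–Schwarz twice)**: `(Σ_{j ∈ s} t_j)⁴ ≤ |s|³ Σ_{j ∈ s} t_j⁴`. Hardy–
Littlewood–Pólya §2.9. [folklore] -/
theorem pow_four_sum_le {ι : Type*} (s : Finset ι) (t : ι → ℝ) :
    (∑ j ∈ s, t j) ^ 4 ≤ (s.card : ℝ) ^ 3 * ∑ j ∈ s, t j ^ 4 := by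
  have h1 : (∑ j ∈ s, t j) ^ 2 ≤ s.card * ∑ j ∈ s, t j ^ 2 := sq_sum_le_card_mul_sum_sq
  have h2 : (∑ j ∈ s, t j ^ 2) ^ 2 ≤ s.card * ∑ j ∈ s, (t j ^ 2) ^ 2 := sq_sum_le_card_mul_sum_sq
  have h0 : 0 ≤ (∑ j ∈ s, t j) ^ 2 := sq_nonneg _
  have hc : (0 : ℝ) ≤ s.card := Nat.cast_nonneg _
  calc (∑ j ∈ s, t j) ^ 4 = ((∑ j ∈ s, t j) ^ 2) ^ 2 := by ring
    _ ≤ (s.card * ∑ j ∈ s, t j ^ 2) ^ 2 := pow_le_pow_left₀ h0 h1 2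
    _ = (s.card : ℝ) ^ 2 * (∑ j ∈ s, t j ^ 2) ^ 2 := by ring
    _ ≤ (s.card : ℝ) ^ 2 * (s.card * ∑ j ∈ s, (t j ^ 2) ^ 2) :=
        mul_le_mul_of_nonneg_left h2 (by positivity)
    _ = (s.card : ℝ) ^ 3 * ∑ j ∈ s, t j ^ 4 := by
        rw [Finset.mul_sum, Finset.mul_sum, Finset.mul_sum]
        refine Finset.sum_congr rfl fun j _ => ?_
        ring

/-- From `T⁴ ≤ X`: `T² ≤ √X`. [folklore] -/
theorem sq_le_sqrt_of_pow_four_le {T X : ℝ} (h : T ^ 4 ≤ X) : T ^ 2 ≤ Real.sqrt X := by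
  have h2 : (T ^ 2) ^ 2 ≤ X := by
    calc (T ^ 2) ^ 2 = T ^ 4 := by ring
      _ ≤ X := h
  calc T ^ 2 = Real.sqrt ((T ^ 2) ^ 2) := (Real.sqrt_sq (by positivity)).symm
    _ ≤ Real.sqrt X := Real.sqrt_le_sqrt h2

/-! ### One block: the shell split -/

/-- **One block.** For occupations `x_j ∈ [0,1]`, level distances `w_j ≥ 0`, a shell width `τ > 0`
with `#{j : w_j ≤ τ} ≤ N`: `(Σ_j (x_j(1-x_j))^{1/4})² ≤ 2 N² + 2 √(M³ D / τ)`, `M = |J|`,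
`D = Σ_j w_j x_j (1 - x_j)` (shell modes contribute `≤ 1` each; off the shell
`t⁴ = x(1-x) ≤ w x(1-x)/τ` and the power mean). Bardeen–Cooper–Schrieffer (1957) §II. [folklore] -/
theorem sq_sum_quarticMean_le {J : Type*} [Fintype J] (x w : J → ℝ) (hx0 : ∀ j, 0 ≤ x j)
    (hx1 : ∀ j, x j ≤ 1) (hw : ∀ j, 0 ≤ w j) {τ : ℝ} (hτ : 0 < τ) {N : ℝ}
    (hN : (((Finset.univ : Finset J).filter fun j => w j ≤ τ).card : ℝ) ≤ N) :
    (∑ j, Real.sqrt (Real.sqrt (x j * (1 - x j)))) ^ 2 ≤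
      2 * N ^ 2 + 2 * Real.sqrt ((Fintype.card J : ℝ) ^ 3 * (∑ j, w j * (x j * (1 - x j))) / τ) := by
  classical
  set t : J → ℝ := fun j => Real.sqrt (Real.sqrt (x j * (1 - x j))) with ht
  set S : Finset J := (Finset.univ : Finset J).filter fun j => w j ≤ τ with hS
  have ht0 : ∀ j, 0 ≤ t j := fun j => Real.sqrt_nonneg _
  have ht1 : ∀ j, t j ≤ 1 := fun j => sqrt_sqrt_mul_one_sub_le_one (hx0 j) (hx1 j)
  have hxx : ∀ j, 0 ≤ x j * (1 - x j) := fun j => mul_nonneg (hx0 j) (by linarith [hx1 j])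
  have ht4 : ∀ j, t j ^ 4 = x j * (1 - x j) := fun j => by
    simp only [ht]
    rw [show (4 : ℕ) = 2 * 2 from rfl, pow_mul, Real.sq_sqrt (Real.sqrt_nonneg _),
      Real.sq_sqrt (hxx j)]
  -- split the sum over the shell `S` and its complement
  rw [← Finset.sum_add_sum_compl S]
  -- shell part
  have hshell : ∑ j ∈ S, t j ≤ N :=
    calc ∑ j ∈ S, t j ≤ ∑ _j ∈ S, (1 : ℝ) := Finset.sum_le_sum fun j _ => ht1 j
      _ = S.card := by rw [Finset.sum_const, nsmul_eq_mul, mul_one]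
      _ ≤ N := hN
  -- off-shell part: `t⁴ ≤ w x(1-x) / τ`
  have hoff4 : ∀ j ∈ Sᶜ, t j ^ 4 ≤ w j * (x j * (1 - x j)) / τ := by
    intro j hj
    rw [Finset.mem_compl, hS, Finset.mem_filter, not_and] at hj
    have hwj : τ < w j := lt_of_not_ge (hj (Finset.mem_univ j))
    rw [ht4, le_div_iff₀ hτ]
    calc x j * (1 - x j) * τ ≤ x j * (1 - x j) * w j :=
          mul_le_mul_of_nonneg_left hwj.le (hxx j)
      _ = w j * (x j * (1 - x j)) := by ring
  have hT4 : (∑ j ∈ Sᶜ, t j) ^ 4 ≤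
      (Fintype.card J : ℝ) ^ 3 * (∑ j, w j * (x j * (1 - x j))) / τ := by
    calc (∑ j ∈ Sᶜ, t j) ^ 4 ≤ (Sᶜ.card : ℝ) ^ 3 * ∑ j ∈ Sᶜ, t j ^ 4 := pow_four_sum_le _ _
      _ ≤ (Fintype.card J : ℝ) ^ 3 * ∑ j ∈ Sᶜ, (w j * (x j * (1 - x j)) / τ) := by
          refine mul_le_mul (pow_le_pow_left₀ (Nat.cast_nonneg _)
            (by exact_mod_cast Finset.card_le_univ _) 3) (Finset.sum_le_sum hoff4)
            (Finset.sum_nonneg fun j _ => by positivity) (by positivity)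
      _ ≤ (Fintype.card J : ℝ) ^ 3 * ∑ j, (w j * (x j * (1 - x j)) / τ) := by
          refine mul_le_mul_of_nonneg_left ?_ (by positivity)
          exact Finset.sum_le_univ_sum_of_nonneg fun j => div_nonneg (mul_nonneg (hw j) (hxx j)) hτ.le
      _ = (Fintype.card J : ℝ) ^ 3 * (∑ j, w j * (x j * (1 - x j))) / τ := by
          rw [← Finset.sum_div, mul_div_assoc]
  have hT2 := sq_le_sqrt_of_pow_four_le hT4
  have hsum0 : 0 ≤ ∑ j ∈ S, t j := Finset.sum_nonneg fun j _ => ht0 j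
  have hN0 : 0 ≤ N := le_trans (Nat.cast_nonneg _) hN
  nlinarith [sq_nonneg (∑ j ∈ S, t j - ∑ j ∈ Sᶜ, t j), mul_le_mul hshell hshell hsum0 hN0]

/-! ### Sum over the translates -/

/-- **Aggregation of the block pair Gram bounds.** For translates `a ∈ A` and block modes `j ∈ J`
(`M = |J|`): occupations `x_{aj} ∈ [0,1]`, level distances `w_j ≥ 0` with shell count
`#{j : w_j ≤ τ} ≤ N` (`τ > 0`), per-translate bounds `m_a ≤ P + Q (Σ_j x_{aj} + (Σ_j t_{aj})²)`
(`Q ≥ 0`, `t = (x(1-x))^{1/4}`) and the budget `Σ_a Σ_j w_j x_{aj}(1-x_{aj}) ≤ Bud` give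
`Σ_a m_a ≤ |A| (P + Q M + 2 Q N²) + 2 Q √(M³ |A| Bud / τ)`.
Bardeen–Cooper–Schrieffer (1957) §II; Hardy–Littlewood–Pólya §2.9. [folklore] -/
theorem sum_le_of_gram_shell_budget {A J : Type*} [Fintype A] [Fintype J] (x : A → J → ℝ)
    (hx0 : ∀ a j, 0 ≤ x a j) (hx1 : ∀ a j, x a j ≤ 1) (w : J → ℝ) (hw : ∀ j, 0 ≤ w j) {τ : ℝ}
    (hτ : 0 < τ) {N : ℝ} (hN : (((Finset.univ : Finset J).filter fun j => w j ≤ τ).card : ℝ) ≤ N)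
    (m : A → ℝ) {P Q : ℝ} (hQ : 0 ≤ Q)
    (hGram : ∀ a, m a ≤ P + Q * (∑ j, x a j + (∑ j, Real.sqrt (Real.sqrt (x a j * (1 - x a j)))) ^ 2))
    {Bud : ℝ} (hBud : ∑ a, ∑ j, w j * (x a j * (1 - x a j)) ≤ Bud) :
    ∑ a, m a ≤ (Fintype.card A : ℝ) * (P + Q * Fintype.card J + 2 * Q * N ^ 2) +
      2 * Q * Real.sqrt ((Fintype.card J : ℝ) ^ 3 * ((Fintype.card A : ℝ) * Bud) / τ) := by
  classical
  set D : A → ℝ := fun a => ∑ j, w j * (x a j * (1 - x a j)) with hD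
  have hD0 : ∀ a, 0 ≤ D a := fun a => Finset.sum_nonneg fun j _ =>
    mul_nonneg (hw j) (mul_nonneg (hx0 a j) (by linarith [hx1 a j]))
  have hM0 : (0 : ℝ) ≤ (Fintype.card J : ℝ) ^ 3 := by positivity
  -- per translate
  have hper : ∀ a, m a ≤ P + Q * Fintype.card J + 2 * Q * N ^ 2 +
      2 * Q * Real.sqrt ((Fintype.card J : ℝ) ^ 3 / τ) * Real.sqrt (D a) := by
    intro a
    have hx : ∑ j, x a j ≤ Fintype.card J :=
      calc ∑ j, x a j ≤ ∑ _j : J, (1 : ℝ) := Finset.sum_le_sum fun j _ => hx1 a j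
        _ = Fintype.card J := by rw [Finset.sum_const, nsmul_eq_mul, mul_one, Finset.card_univ]
    have hsq := sq_sum_quarticMean_le (x a) w (hx0 a) (hx1 a) hw hτ hN
    have hsplit : Real.sqrt ((Fintype.card J : ℝ) ^ 3 * D a / τ) =
        Real.sqrt ((Fintype.card J : ℝ) ^ 3 / τ) * Real.sqrt (D a) := by
      rw [← Real.sqrt_mul (div_nonneg hM0 hτ.le), div_mul_eq_mul_div]
    rw [hsplit] at hsq
    have h1 := hGram a
    nlinarith [mul_nonneg hQ (Real.sqrt_nonneg ((Fintype.card J : ℝ) ^ 3 / τ)),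
      Real.sqrt_nonneg (D a)]
  -- Cauchy–Schwarz over the translates: `Σ_a √D_a ≤ √(|A| Σ_a D_a) ≤ √(|A| Bud)`
  have hCS : ∑ a, Real.sqrt (D a) ≤ Real.sqrt ((Fintype.card A : ℝ) * Bud) := by
    have h1 : (∑ a, Real.sqrt (D a)) ^ 2 ≤ Fintype.card A * ∑ a, Real.sqrt (D a) ^ 2 := by
      have := sq_sum_le_card_mul_sum_sq (s := (Finset.univ : Finset A)) (f := fun a => Real.sqrt (D a))
      simpa [Finset.card_univ] using this
    have h2 : ∑ a, Real.sqrt (D a) ^ 2 = ∑ a, D a :=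
      Finset.sum_congr rfl fun a _ => Real.sq_sqrt (hD0 a)
    rw [h2] at h1
    have h3 : (∑ a, Real.sqrt (D a)) ^ 2 ≤ Fintype.card A * Bud :=
      h1.trans (mul_le_mul_of_nonneg_left hBud (Nat.cast_nonneg _))
    calc ∑ a, Real.sqrt (D a) = Real.sqrt ((∑ a, Real.sqrt (D a)) ^ 2) :=
          (Real.sqrt_sq (Finset.sum_nonneg fun a _ => Real.sqrt_nonneg _)).symm
      _ ≤ Real.sqrt ((Fintype.card A : ℝ) * Bud) := Real.sqrt_le_sqrt h3
  calc ∑ a, m a ≤ ∑ a, (P + Q * Fintype.card J + 2 * Q * N ^ 2 +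
        2 * Q * Real.sqrt ((Fintype.card J : ℝ) ^ 3 / τ) * Real.sqrt (D a)) := Finset.sum_le_sum fun a _ => hper a
    _ = (Fintype.card A : ℝ) * (P + Q * Fintype.card J + 2 * Q * N ^ 2) +
        2 * Q * Real.sqrt ((Fintype.card J : ℝ) ^ 3 / τ) * ∑ a, Real.sqrt (D a) := by
        rw [Finset.sum_add_distrib, Finset.sum_const, nsmul_eq_mul, Finset.card_univ, Finset.mul_sum]
    _ ≤ (Fintype.card A : ℝ) * (P + Q * Fintype.card J + 2 * Q * N ^ 2) +
        2 * Q * Real.sqrt ((Fintype.card J : ℝ) ^ 3 / τ) * Real.sqrt ((Fintype.card A : ℝ) * Bud) := by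
        gcongr
    _ = _ := by
        rw [mul_assoc (2 * Q), ← Real.sqrt_mul (div_nonneg hM0 hτ.le), div_mul_eq_mul_div]

/-- **Registered stub** (`stub_coarseAggregate`, crux stmt-HubbardSuperconductivity-18534): the
aggregation lemma with translates `(ℤ/L)²` and block modes `[0,R)²`.
Bardeen–Cooper–Schrieffer (1957) §II; Hardy–Littlewood–Pólya §2.9. [folklore] -/
theorem stub_coarseAggregate :
    ∀ (L : ℕ) [NeZero L] (R : ℕ) (x : TorusSite 2 L → (Fin 2 → Fin R) → ℝ),
      (∀ a j, 0 ≤ x a j) → (∀ a j, x a j ≤ 1) →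
      ∀ (w : (Fin 2 → Fin R) → ℝ), (∀ j, 0 ≤ w j) → ∀ (τ : ℝ), 0 < τ → ∀ (N : ℝ),
        (((Finset.univ : Finset (Fin 2 → Fin R)).filter fun j => w j ≤ τ).card : ℝ) ≤ N →
        ∀ (m : TorusSite 2 L → ℝ) (P Q : ℝ), 0 ≤ Q →
          (∀ a, m a ≤ P + Q * (∑ j, x a j + (∑ j, Real.sqrt (Real.sqrt (x a j * (1 - x a j)))) ^ 2)) →
          ∀ (Bud : ℝ), (∑ a, ∑ j, w j * (x a j * (1 - x a j)) ≤ Bud) →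
            ∑ a, m a ≤ (Fintype.card (TorusSite 2 L) : ℝ) *
                (P + Q * Fintype.card (Fin 2 → Fin R) + 2 * Q * N ^ 2) +
              2 * Q * Real.sqrt ((Fintype.card (Fin 2 → Fin R) : ℝ) ^ 3 *
                ((Fintype.card (TorusSite 2 L) : ℝ) * Bud) / τ) :=
  fun _ _ _ x hx0 hx1 w hw _ hτ _ hN m _ _ hQ hGram _ hBud =>
    sum_le_of_gram_shell_budget x hx0 hx1 w hw hτ hN m hQ hGram hBud

end Summit.HubbardSuperconductivity.HubbardSuperconductivity.Theorems.CoarseTightness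

end
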